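import Summits.ResolutionOfSingularities.ResolutionOfSingularities.Theorems.HomologicalConductorNoZenoCentreBaseChange
import Summits.ResolutionOfSingularities.ResolutionOfSingularities.Theorems.HomologicalConductorNoZenoHtwoDischarge
import Summits.ResolutionOfSingularities.ResolutionOfSingularities.Theorems.HomologicalConductorNoZenoHfibreSplitting
import Summits.ResolutionOfSingularities.ResolutionOfSingularities.Theorems.HomologicalConductorNoZenoHalgNode
import Summits.ResolutionOfSingularities.ResolutionOfSingularities.Theorems.HomologicalConductorNoZenoExcCurveLift
import Summits.ResolutionOfSingularities.ResolutionOfSingularities.Theorems.HomologicalConductorNoZenoUpstairsCount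
import Summits.ResolutionOfSingularities.ResolutionOfSingularities.Theorems.HomologicalConductorNoZenoSplitDataThread
import HarnessLib

/-!
# Crux `NoZenoR` (stmt-ResolutionOfSingularities-19943), slot 5 `stub_L1wCoreF3`, seam0/seam2 — `hsplitf_upstairs`:
# the `hsplitf` binder of the closer core `l1wCore_of_sandwichData`, from ONE splitting clause

OURS (cell res-hironaka, chain W4.4; stub worker res-L0-w44-stub-4 g8; object (1) of res-L0-w44-plan-1 DESK WORD 33
2026-08-27T22:12:52Z).  Nothing here is a statement of the manuscript under review (Hironaka 2017); AI-written, weaker than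
expert review; def-free, fact-free (the named facts `Lipman1969_13_1_d_rat`, `Lipman1969_16_5` enter as explicit hypotheses and
are never discharged here).

THE OUTPUT is the `hsplitf` binder of `l1wCore_of_sandwichData` (res-L0-w44-lead-1, `…NoZenoL1wCoreOfSandwichData` :105–112)
VERBATIM: for the thread germ `D = T_P` (`locPrime T P hP` / `locPrimeSubalgebra T P hP`), ONE thread polynomial `f` with its
one-root germ `D_f = locPrime (splitModel D f) (splitPrime D f)` and `g : Spec D_f → Spec D`, the resolution `π : X → Spec D`, its
node blow-up `ρ : X¹ → X` (centre `closure (sepNodes π)`), and the pulled-back resolution `π_f := pullback.snd π g`,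
`σ := pullback.fst π g`:
`∀ z₁ ∈ σ⁻¹(sepNodes π), ∃ a ≠ b ∈ excCurvePoints π_f, a ⤳ z₁ ∧ b ⤳ z₁`.

THE INPUT, besides the habitat data, is res-D-pv-039's SPLITTING CLAUSE in the literal output shape of
`exists_splitting_threadPoly` (p576859) for `π¹ := ρ ≫ π` on any set `S ⊆ X¹` containing the (finitely many) points lying on two
distinct exceptional curves of `ρ ≫ π` (`hSY`, `hclause`), and `IsResolution π_f` (`hπf`, (U2)).

PROOF = res-D-pv-045's `hsplit_upstairs_pullback` (p574326) with its self-node input `htwo` DISCHARGED by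
`htwo_discharge_of_inter` (p576385): `hnode` from res-L1-type-o5's `FiniteCentreBlowup.exists_curve_fibre_eq_closure`, `hlift` from
res-L0-w44-stub-3's `exists_mem_excCurvePoints_apply_eq_and_bijective`, and `hfibre` from res-D-pv-039's `hfibre_of_splitting`
(p577472) fed with `isAlgebraic_residueField_of_specializes` (`…NoZenoHalgNode`) and the clause at `y`; the instances on
`σ`/`g` (finite, flat, formally unramified) from res-D-pv-039's one-root germ (`finite_germ`, `flat_germ`, `etale_germ`).

SIBLING: res-D-pv-039's `…NoZenoSandwichData.exists_sandwichData` packages all eight upstairs binders of the closer (including an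
`hsplitf` obtained along the same route) behind one `∃ f`; this file is the reusable standalone form of the `hsplitf` component
(res-L0-w44-plan-1 DESK WORD 34).

References: J. Lipman, Publ. Math. IHÉS 36 (1969), §16 (16.1) p. 231, §24 p. 258 [`Lipman1969`]; U. Görtz, T. Wedhorn,
*Algebraic Geometry I* (2020), Prop. 13.91 (2), Lemma 14.9 [`GortzWedhorn2020`].
-/

noncomputable section

-- single-problem summit: the doubled namespace component `ResolutionOfSingularities` is forced
set_option linter.dupNamespace false

namespace Summit.ResolutionOfSingularities.ResolutionOfSingularities.Theorems.NoZeno.ExcCount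

open CategoryTheory CategoryTheory.Limits AlgebraicGeometry TopologicalSpace Topology IsLocalRing Polynomial
open Literature.AlgebraicGeometry.Resolution Scheme.IdealSheafData
open Summit.ResolutionOfSingularities.ResolutionOfSingularities.Theorems.NoZeno.SandwichCluster
open Summit.ResolutionOfSingularities.ResolutionOfSingularities.Theorems.NoZeno.SandwichCluster.Parasite
  (locPrime isLocalRing_locPrime)
open Summit.ResolutionOfSingularities.ResolutionOfSingularities.Theorems.NoZeno.SplittingBase
open scoped TensorProduct

variable {k K : Type} [Field k] [Field K] [Algebra k K]

/-- **`hsplitf` UPSTAIRS — two distinct exceptional curves of `π_f` through every point of `σ⁻¹(sepNodes π)`, from ONE splitting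
clause.**  See the module docstring.  Conditional on `Lipman1969_13_1_d_rat` (through (S1)/(T1)) and `Lipman1969_16_5` (rationality
of the upstairs germ). [cite: Lipman1969, §16 (16.1) (p. 231) and §24 (p. 258)] -/
theorem hsplitf_upstairs (h131d : Lipman1969_13_1_d_rat.{0}) (h165 : Lipman1969_16_5.{0})
    (T : Subalgebra k K) (P : Ideal ↥T) (hP : P.IsPrime)
    [Algebra.EssFiniteType k ↥T] [IsIntegrallyClosed ↥T] [IsFractionRing ↥T K]
    (hdim : ringKrullDim ↥(locPrime T P hP) = 2) (hrat : HasRationalSingularity ↥(locPrime T P hP))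
    {X : Scheme.{0}} (π : X ⟶ Spec (.of ↥(locPrime T P hP))) (hπ : IsResolution π)
    {X1 : Scheme.{0}} (ρ : X1 ⟶ X) (hρ : IsBlowup ρ (vanishingIdeal ⟨closure (sepNodes π), isClosed_closure⟩))
    (f : (↥(locPrimeSubalgebra T P hP))[X]) (hf : f.Monic)
    (hirr : Irreducible (f.map (residue ↥(locPrimeSubalgebra T P hP))))
    (hsep : (f.map (residue ↥(locPrimeSubalgebra T P hP))).Separable)
    [Fact (Irreducible (f.map (algebraMap ↥(locPrimeSubalgebra T P hP) K)))]
    (hPf : (splitPrime (locPrimeSubalgebra T P hP) f).IsPrime)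
    (hπf : IsResolution (pullback.snd π (Spec.map (CommRingCat.ofHom (algebraMap ↥(locPrimeSubalgebra T P hP)
        ↥(locPrime (splitModel (locPrimeSubalgebra T P hP) f) (splitPrime (locPrimeSubalgebra T P hP) f) hPf))))))
    -- the finite set carrying the splitting clause: it contains the points lying on two distinct exceptional curves of `ρ ≫ π`
    (S : Set X1)
    (hSY : ∀ (y a b : X1), a ∈ excCurvePoints (ρ ≫ π) → b ∈ excCurvePoints (ρ ≫ π) → a ≠ b → a ⤳ y → b ⤳ y → y ∈ S)
    -- res-D-pv-039's splitting clause (`exists_splitting_threadPoly` for `π¹ := ρ ≫ π` over `Spec (T_P)`), as a hypothesis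
    (hclause : haveI := isLocalHom_germ (locPrimeSubalgebra T P hP) f hf hirr hPf
      ∀ (y : X1) (_ : y ∈ S)
        (hy : (Spec.map (CommRingCat.ofHom (algebraMap ↥(locPrimeSubalgebra T P hP)
            ↥(locPrime (splitModel (locPrimeSubalgebra T P hP) f) (splitPrime (locPrimeSubalgebra T P hP) f) hPf)))).base
            (closedPoint ↥(locPrime (splitModel (locPrimeSubalgebra T P hP) f) (splitPrime (locPrimeSubalgebra T P hP) f) hPf)) =
            (CategoryStruct.comp (Z := Spec (.of ↥(locPrimeSubalgebra T P hP))) ρ π).base y),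
        letI := ((CategoryStruct.comp (Z := Spec (.of ↥(locPrimeSubalgebra T P hP))) ρ π).residueFieldMap y).hom.toAlgebra
        letI := (((Spec (.of ↥(locPrimeSubalgebra T P hP))).residueFieldCongr hy).inv ≫
          (Spec.map (CommRingCat.ofHom (algebraMap ↥(locPrimeSubalgebra T P hP)
              ↥(locPrime (splitModel (locPrimeSubalgebra T P hP) f) (splitPrime (locPrimeSubalgebra T P hP) f) hPf)))).residueFieldMap
            (closedPoint ↥(locPrime (splitModel (locPrimeSubalgebra T P hP) f) (splitPrime (locPrimeSubalgebra T P hP) f) hPf))).hom.toAlgebra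
        ∀ x : separableClosure ((Spec (.of ↥(locPrimeSubalgebra T P hP))).residueField
            ((CategoryStruct.comp (Z := Spec (.of ↥(locPrimeSubalgebra T P hP))) ρ π).base y)) (X1.residueField y),
          ((minpoly ((Spec (.of ↥(locPrimeSubalgebra T P hP))).residueField
            ((CategoryStruct.comp (Z := Spec (.of ↥(locPrimeSubalgebra T P hP))) ρ π).base y)) x).map
            (algebraMap ((Spec (.of ↥(locPrimeSubalgebra T P hP))).residueField
              ((CategoryStruct.comp (Z := Spec (.of ↥(locPrimeSubalgebra T P hP))) ρ π).base y))
              ((Spec (.of ↥(locPrime (splitModel (locPrimeSubalgebra T P hP) f) (splitPrime (locPrimeSubalgebra T P hP) f) hPf))).residueField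
                (closedPoint ↥(locPrime (splitModel (locPrimeSubalgebra T P hP) f) (splitPrime (locPrimeSubalgebra T P hP) f) hPf))))).Splits) :
    ∀ z₁ ∈ (pullback.fst π (Spec.map (CommRingCat.ofHom (algebraMap ↥(locPrimeSubalgebra T P hP)
        ↥(locPrime (splitModel (locPrimeSubalgebra T P hP) f) (splitPrime (locPrimeSubalgebra T P hP) f) hPf))))).base ⁻¹'
        sepNodes π, ∃ a b,
        a ∈ excCurvePoints (pullback.snd π (Spec.map (CommRingCat.ofHom (algebraMap ↥(locPrimeSubalgebra T P hP)
            ↥(locPrime (splitModel (locPrimeSubalgebra T P hP) f) (splitPrime (locPrimeSubalgebra T P hP) f) hPf))))) ∧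
        b ∈ excCurvePoints (pullback.snd π (Spec.map (CommRingCat.ofHom (algebraMap ↥(locPrimeSubalgebra T P hP)
            ↥(locPrime (splitModel (locPrimeSubalgebra T P hP) f) (splitPrime (locPrimeSubalgebra T P hP) f) hPf))))) ∧
        a ≠ b ∧ a ⤳ z₁ ∧ b ⤳ z₁ := by
  -- instances on the germ `T_P` (both spellings) and on `X`
  haveI : IsNoetherianRing ↥T := Algebra.EssFiniteType.isNoetherianRing k ↥T
  haveI : IsNoetherianRing ↥(locPrime T P hP) := inferInstanceAs (IsNoetherianRing ↥(locPrimeSubalgebra T P hP))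
  haveI : IsIntegrallyClosed ↥(locPrime T P hP) := inferInstanceAs (IsIntegrallyClosed ↥(locPrimeSubalgebra T P hP))
  haveI : IsProper π := hπ.isProper
  haveI : IsIntegral X := hπ.isIntegral_source
  haveI : IsLocallyNoetherian X := LocallyOfFiniteType.isLocallyNoetherian π
  have hfin : (excCurvePoints π).Finite := (excPoints_finite π).subset (hπ.excCurvePoints_subset_excPoints hdim)
  -- the one-root germ `D_f` and `g : Spec D_f → Spec D`
  haveI := isNoetherianRing_germ (locPrimeSubalgebra T P hP) f hf hirr hPf
  haveI := isIntegrallyClosed_germ (locPrimeSubalgebra T P hP) f hf hirr hsep hPf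
  haveI := isLocalHom_germ (locPrimeSubalgebra T P hP) f hf hirr hPf
  have hdimf : ringKrullDim ↥(locPrime (splitModel (locPrimeSubalgebra T P hP) f) (splitPrime (locPrimeSubalgebra T P hP) f) hPf) = 2 :=
    (ringKrullDim_germ (locPrimeSubalgebra T P hP) f hf hirr hsep hPf).trans hdim
  have hratf : HasRationalSingularity ↥(locPrime (splitModel (locPrimeSubalgebra T P hP) f) (splitPrime (locPrimeSubalgebra T P hP) f) hPf) :=
    hasRationalSingularity_germ h165 (locPrimeSubalgebra T P hP) f hf hirr hsep hPf hdim hrat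
  -- instances on `g` (keyed as a morphism to `Spec D`, `D` the subalgebra spelling)
  have hgfin : IsFinite (Spec.map (CommRingCat.ofHom (algebraMap ↥(locPrimeSubalgebra T P hP)
      ↥(locPrime (splitModel (locPrimeSubalgebra T P hP) f) (splitPrime (locPrimeSubalgebra T P hP) f) hPf)))) :=
    isFinite_specMap_germ (locPrimeSubalgebra T P hP) f hf hirr hPf
  have hgflat : Flat (Spec.map (CommRingCat.ofHom (algebraMap ↥(locPrimeSubalgebra T P hP)
      ↥(locPrime (splitModel (locPrimeSubalgebra T P hP) f) (splitPrime (locPrimeSubalgebra T P hP) f) hPf)))) := by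
    rw [Flat.SpecMap_iff, CommRingCat.hom_ofHom, RingHom.flat_algebraMap_iff]
    exact flat_germ (locPrimeSubalgebra T P hP) f hf hirr hPf
  have hgfu : FormallyUnramified (Spec.map (CommRingCat.ofHom (algebraMap ↥(locPrimeSubalgebra T P hP)
      ↥(locPrime (splitModel (locPrimeSubalgebra T P hP) f) (splitPrime (locPrimeSubalgebra T P hP) f) hPf)))) := by
    rw [HasRingHomProperty.Spec_iff (P := @FormallyUnramified), CommRingCat.hom_ofHom, RingHom.formallyUnramified_algebraMap]
    haveI := etale_germ (locPrimeSubalgebra T P hP) f hf hirr hsep hPf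
    infer_instance
  have hg := preimage_closedPoint_germ (locPrimeSubalgebra T P hP) f hf hirr hPf
  -- the base change `σ := pullback.fst π g` (there `g` is keyed as a morphism to `Spec (T_P)`) and its instances
  haveI : IsFinite (pullback.fst π (Spec.map (CommRingCat.ofHom (algebraMap ↥(locPrimeSubalgebra T P hP)
      ↥(locPrime (splitModel (locPrimeSubalgebra T P hP) f) (splitPrime (locPrimeSubalgebra T P hP) f) hPf))))) :=
    MorphismProperty.pullback_fst _ _ (by exact hgfin)
  haveI : Flat (pullback.fst π (Spec.map (CommRingCat.ofHom (algebraMap ↥(locPrimeSubalgebra T P hP)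
      ↥(locPrime (splitModel (locPrimeSubalgebra T P hP) f) (splitPrime (locPrimeSubalgebra T P hP) f) hPf))))) :=
    MorphismProperty.pullback_fst _ _ (by exact hgflat)
  haveI : FormallyUnramified (pullback.fst π (Spec.map (CommRingCat.ofHom (algebraMap ↥(locPrimeSubalgebra T P hP)
      ↥(locPrime (splitModel (locPrimeSubalgebra T P hP) f) (splitPrime (locPrimeSubalgebra T P hP) f) hPf))))) :=
    MorphismProperty.pullback_fst _ _ (by exact hgfu)
  haveI : IsIntegral ↑(pullback π (Spec.map (CommRingCat.ofHom (algebraMap ↥(locPrimeSubalgebra T P hP)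
      ↥(locPrime (splitModel (locPrimeSubalgebra T P hP) f) (splitPrime (locPrimeSubalgebra T P hP) f) hPf))))) :=
    hπf.isIntegral_source
  -- (S3) for the pulled-back square, modulo `htwo`
  refine hsplit_upstairs_pullback π (pullback.snd π (Spec.map (CommRingCat.ofHom (algebraMap ↥(locPrimeSubalgebra T P hP)
      ↥(locPrime (splitModel (locPrimeSubalgebra T P hP) f) (splitPrime (locPrimeSubalgebra T P hP) f) hPf)))))
    (pullback.fst π (Spec.map (CommRingCat.ofHom (algebraMap ↥(locPrimeSubalgebra T P hP)
        ↥(locPrime (splitModel (locPrimeSubalgebra T P hP) f) (splitPrime (locPrimeSubalgebra T P hP) f) hPf)))))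
    (Spec.map (CommRingCat.ofHom (algebraMap ↥(locPrimeSubalgebra T P hP)
        ↥(locPrime (splitModel (locPrimeSubalgebra T P hP) f) (splitPrime (locPrimeSubalgebra T P hP) f) hPf))))
    pullback.condition hg ρ h131d hdimf hratf hπf hfin hρ ?_
  -- the node blow-up in finite-centre form
  have hC : (⟨closure (sepNodes π), isClosed_closure⟩ : Closeds X) = ⟨sepNodes π, isClosed_sepNodes π hfin⟩ :=
    Closeds.ext (closure_sepNodes_eq π hfin)
  have hρ' : IsBlowup ρ (vanishingIdeal ⟨sepNodes π, isClosed_sepNodes π hfin⟩) := hC ▸ hρ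
  have hNfin : (sepNodes π).Finite := sepNodes_finite π hfin
  have hNcl : ∀ z ∈ sepNodes π, IsClosed ({z} : Set X) := fun z hz => isClosed_singleton_of_mem_sepNodes π hz
  have hNexc : ∀ z ∈ sepNodes π, ∃ η ∈ excCurvePoints π, η ⤳ z ∧ z ≠ η := fun z hz =>
    exists_excCurvePoint_specializes_of_mem_sepNodes π hz
  haveI : IsProper ρ := FiniteCentreBlowup.isProper π ρ (isClosed_sepNodes π hfin) hρ'
  haveI : IsIntegral X1 := FiniteCentreBlowup.isIntegral π ρ (isClosed_sepNodes π hfin) hNcl hNexc hρ'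
  have hψ : IsResolution (ρ ≫ π) :=
    FiniteCentreBlowup.isResolution_comp π ρ (isClosed_sepNodes π hfin) hNfin hNcl hNexc hπ hρ'
  haveI : IsProper (ρ ≫ π) := hψ.isProper
  haveI : IsLocallyNoetherian X1 := LocallyOfFiniteType.isLocallyNoetherian (ρ ≫ π)
  have hnode := FiniteCentreBlowup.exists_curve_fibre_eq_closure π ρ (isClosed_sepNodes π hfin) hNfin hNcl hNexc hdim hπ hρ'
  have hlift : ∀ η ∈ excCurvePoints π, ∃ η1 ∈ excCurvePoints (ρ ≫ π), ρ.base η1 = η ∧ Function.Bijective (ρ.stalkMap η1) :=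
    fun η hη => exists_mem_excCurvePoints_apply_eq_and_bijective π ρ hdim hψ hπ hη
  obtain ⟨himg, -⟩ := FiniteCentreBlowup.excCurvePoints_eq_image π ρ (isClosed_sepNodes π hfin) hNcl hnode hρ'
    (fun w hw => hψ.height_le_one_of_base_eq_closedPoint hdim hw)
  refine htwo_discharge_of_inter π (pullback.fst π (Spec.map (CommRingCat.ofHom (algebraMap ↥(locPrimeSubalgebra T P hP)
      ↥(locPrime (splitModel (locPrimeSubalgebra T P hP) f) (splitPrime (locPrimeSubalgebra T P hP) f) hPf))))) ρ
    (pullback.snd ρ (pullback.fst π (Spec.map (CommRingCat.ofHom (algebraMap ↥(locPrimeSubalgebra T P hP)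
        ↥(locPrime (splitModel (locPrimeSubalgebra T P hP) f) (splitPrime (locPrimeSubalgebra T P hP) f) hPf))))))
    (pullback.fst ρ (pullback.fst π (Spec.map (CommRingCat.ofHom (algebraMap ↥(locPrimeSubalgebra T P hP)
        ↥(locPrime (splitModel (locPrimeSubalgebra T P hP) f) (splitPrime (locPrimeSubalgebra T P hP) f) hPf))))))
    h131d hdim hrat hψ (IsPullback.of_hasPullback _ _) hnode hlift ?_
  -- the field step at a point `y` on two distinct exceptional curves of `ρ ≫ π`
  intro y a b ha hb hab hay hby z₁ h
  -- `y` is a proper specialisation of `a`, so a point of height `0`, and so is `ρ y`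
  have hya : y ≠ a := by
    rintro rfl
    have hlt : y < b := lt_iff_le_not_ge.mpr ⟨Scheme.le_iff_specializes.mpr hby, fun hge =>
      hab ((Scheme.le_iff_specializes.mp hge).antisymm hby).eq⟩
    have h2 := Order.height_add_one_le hlt
    rw [ha.2, hb.2] at h2
    norm_num at h2
  have hlt : y < a := lt_iff_le_not_ge.mpr ⟨Scheme.le_iff_specializes.mpr hay, fun hge =>
    hya ((Scheme.le_iff_specializes.mp hge).antisymm hay).eq⟩
  have hy0 : Order.height y = 0 := by
    have h1 := Order.height_add_one_le hlt
    rw [ha.2] at h1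
    generalize Order.height y = m at h1 ⊢
    induction m using ENat.recTopCoe with
    | top => simp at h1
    | coe n => norm_cast at h1 ⊢; omega
  have hρy0 : Order.height (ρ.base y) = 0 :=
    nonpos_iff_eq_zero.mp (hy0 ▸ height_apply_le_of_isClosedMap ρ ρ.isClosedMap y)
  have hρπy : (ρ ≫ π).base y = closedPoint ↥(locPrime T P hP) := base_eq_closedPoint_of_specializes (ρ ≫ π) ha.1 hay
  -- an exceptional curve of `π` through `ρ y` (old curve `ρ a`, or a curve through the node `ρ a = ρ y`)
  have hcurve : ∃ η ∈ excCurvePoints π, η ⤳ ρ.base y ∧ ρ.base y ≠ η := by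
    by_cases haN : ρ.base a ∈ sepNodes π
    · obtain ⟨η, hη, hηa, -⟩ := hNexc _ haN
      refine ⟨η, hη, hηa.trans (hay.map ρ.base.hom.continuous), fun he => ?_⟩
      have h1 := hη.2
      rw [← he, hρy0] at h1
      exact zero_ne_one h1
    · have hmem : ρ.base a ∈ excCurvePoints π := by
        rw [himg]; exact ⟨a, ⟨ha, fun hn => haN hn.2⟩, rfl⟩
      refine ⟨ρ.base a, hmem, hay.map ρ.base.hom.continuous, fun he => ?_⟩
      have h1 := hmem.2
      rw [← he, hρy0] at h1
      exact zero_ne_one h1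
  obtain ⟨η, hη, hηy, hne⟩ := hcurve
  have halg := isAlgebraic_residueField_of_specializes π hη hηy hne
  -- `z₁` lies over the closed point of `D_f`; `g 𝔪_f = (ρ ≫ π) y`
  have hz₁ : (pullback.snd π (Spec.map (CommRingCat.ofHom (algebraMap ↥(locPrimeSubalgebra T P hP)
      ↥(locPrime (splitModel (locPrimeSubalgebra T P hP) f) (splitPrime (locPrimeSubalgebra T P hP) f) hPf))))).base z₁ =
      closedPoint ↥(locPrime (splitModel (locPrimeSubalgebra T P hP) f) (splitPrime (locPrimeSubalgebra T P hP) f) hPf) := by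
    have h1 : (pullback.fst π (Spec.map (CommRingCat.ofHom (algebraMap ↥(locPrimeSubalgebra T P hP)
        ↥(locPrime (splitModel (locPrimeSubalgebra T P hP) f) (splitPrime (locPrimeSubalgebra T P hP) f) hPf)))) ≫ π).base z₁ =
        closedPoint ↥(locPrime T P hP) := by
      rw [Scheme.Hom.comp_apply, h]
      exact hρπy
    rw [pullback.condition] at h1
    have h2 : (pullback.snd π (Spec.map (CommRingCat.ofHom (algebraMap ↥(locPrimeSubalgebra T P hP)
        ↥(locPrime (splitModel (locPrimeSubalgebra T P hP) f) (splitPrime (locPrimeSubalgebra T P hP) f) hPf))))).base z₁ ∈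
        (Spec.map (CommRingCat.ofHom (algebraMap ↥(locPrimeSubalgebra T P hP)
            ↥(locPrime (splitModel (locPrimeSubalgebra T P hP) f) (splitPrime (locPrimeSubalgebra T P hP) f) hPf)))).base ⁻¹'
          {closedPoint ↥(locPrimeSubalgebra T P hP)} := h1
    exact hg.subset h2
  have hy' : (Spec.map (CommRingCat.ofHom (algebraMap ↥(locPrimeSubalgebra T P hP)
      ↥(locPrime (splitModel (locPrimeSubalgebra T P hP) f) (splitPrime (locPrimeSubalgebra T P hP) f) hPf)))).base
      (closedPoint ↥(locPrime (splitModel (locPrimeSubalgebra T P hP) f) (splitPrime (locPrimeSubalgebra T P hP) f) hPf)) =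
      (CategoryStruct.comp (Z := Spec (.of ↥(locPrimeSubalgebra T P hP))) ρ π).base y :=
    (specMap_closedPoint ↥(locPrimeSubalgebra T P hP)
      ↥(locPrime (splitModel (locPrimeSubalgebra T P hP) f) (splitPrime (locPrimeSubalgebra T P hP) f) hPf)).trans hρπy.symm
  exact hfibre_of_splitting π ρ (pullback.fst π (Spec.map (CommRingCat.ofHom (algebraMap ↥(locPrimeSubalgebra T P hP)
      ↥(locPrime (splitModel (locPrimeSubalgebra T P hP) f) (splitPrime (locPrimeSubalgebra T P hP) f) hPf)))))
    (pullback.snd π (Spec.map (CommRingCat.ofHom (algebraMap ↥(locPrimeSubalgebra T P hP)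
        ↥(locPrime (splitModel (locPrimeSubalgebra T P hP) f) (splitPrime (locPrimeSubalgebra T P hP) f) hPf)))))
    (Spec.map (CommRingCat.ofHom (algebraMap ↥(locPrimeSubalgebra T P hP)
        ↥(locPrime (splitModel (locPrimeSubalgebra T P hP) f) (splitPrime (locPrimeSubalgebra T P hP) f) hPf))))
    pullback.condition y z₁ h hz₁ hy' halg
    (hclause y (hSY y a b ha hb hab hay hby) hy')

end Summit.ResolutionOfSingularities.ResolutionOfSingularities.Theorems.NoZeno.ExcCount

end
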